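import Mathlib
import HarnessLib
import Literature.Analysis.FluidPDE.FluidComputer.GalerkinEnergyBalance

/-!
# Band mode counts: the lattice shells of the cell's sharp bands as finite sets of `ℤ³` and their
# cardinalities `M = 308 / 96 / 2484 / 17408 / 20164 / 129788`, certified by the kernel through a structured count

Cell `pub-fluidc` (FLUID COMPUTER; host summit `NavierStokesRegularity`, negation side, machine paradigm),
prover seat p1 gen 14 (2026-08-26). HONEST FRAMING (verbatim): *low prior, high value-of-information
experiment on Tao's machine paradigm; NOT a claim that NS blows up.* Nothing in this file concerns the
Navier–Stokes or Euler evolution.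

The cell's coherence ledger (`CoherenceLedger`, `BandSupCeiling`, HOME/STATUS l.5237 / l.5245, deposit
`atlas/rung-next/p1/coherence-time/`) normalises a band's peak factor by the kinematic ceiling
`U_B² ≤ (4/3)·#B·E_B` (`BandSupCeiling.field_real_normSq_le`), where `#B` is the number of lattice modes of
the band. The readers print `M_in = 308`, `M_out = 2484`, `M_out2i = 17408`, `M_out2 = 20164`,
`M_out3i = 129788`, `M_mid = 96` for the sharp bands `[2.5,4.5)`, `[5,9)`, `[9,17)`, `[10,18)`, `[17,33)`,
`[4.5,5)` in `|k|`, and `CoherenceLedger.q2_mode_normalised` uses `3/(2·308)`, `3/(2·2484)`, `3/(2·17408)`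
as bare constants (`pub-fluidc-p1/lean/CERT-DECLS.md` §5: 'the readers are Python of record'). This module
makes the constants kernel facts:

* `shell K lo hi` — the lattice shell `{k ∈ ℤ³ : lo ≤ |k|² < hi}` as a `Finset (Fin 3 → ℤ)` (built inside
  the box `[-K, K]³`; `mem_shell_iff`: the box is immaterial once `hi ≤ (K+1)²`, so this IS the shell), and
  the named bands `shellIn`, `shellMid`, `shellOut`, `shellOut2i`, `shellOut2`, `shellOut3i`
  (integer thresholds `7 ≤ |k|² < 21` for `2.5 ≤ |k| < 4.5`, etc.; the real-threshold form and the band sup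
  ceiling on these sets are in the companion module `BandShellCeiling`);
* `card_shell` — a STRUCTURED count: `#shell = Σ_{a ≤ K} w(a) Σ_{b ≤ K} w(b) Σ_{c ≤ K} w(c)·[lo ≤ a²+b²+c² < hi]`
  over `ℕ³` with sign weights `w(0) = 1`, `w(n+1) = 2` (each coordinate folded by `x ↦ |x|`,
  `sum_Icc_symm`), so the kernel evaluates `(K+1)³` small natural-number terms (`decide +kernel`, ≈ 10 s
  for all six bands together) instead of a `(2K+1)³`-point filter of `ℤ³` — no `native_decide`;
* the numbers `card_shellIn = 308`, `card_shellMid = 96`, `card_shellOut = 2484`,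
  `card_shellOut2i = 17408`, `card_shellOut2 = 20164`, `card_shellOut3i = 129788`; the consecutive-octave
  ratios `8.065 / 7.008 / 7.456` against the continuum `λ³ = 8`; and `|M − (4π/3)(b³ − a³)| ≤ 3 %`.

Elementary finite combinatorics and `norm_num` arithmetic; no named facts (D-0026).
-/

namespace Summit.NavierStokesRegularity.FluidComputer.BandModeCounts

open Finset
open Literature.Analysis.FluidPDE.FluidComputer Literature.Analysis.FluidPDE.FluidComputer.ShellTransfer
open scoped BigOperators

/-! ## 1. The lattice shell as a finite set of `ℤ³` -/

/-- Integer `|k|² = k₀² + k₁² + k₂²` of a wavevector. -/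
def isq (k : Fin 3 → ℤ) : ℤ := ∑ i, k i ^ 2

/-- `|k|²` expanded. -/
theorem isq_eq (k : Fin 3 → ℤ) : isq k = k 0 ^ 2 + k 1 ^ 2 + k 2 ^ 2 := by
  unfold isq; rw [Fin.sum_univ_three]

/-- The real `|k|²` of the tree (`ShellTransfer.knormSq`) is the cast of the integer one. -/
theorem knormSq_eq_cast (k : Fin 3 → ℤ) : knormSq k = (isq k : ℝ) := by
  unfold knormSq isq; push_cast; rfl

/-- `0 ≤ |k|²`. -/
theorem isq_nonneg (k : Fin 3 → ℤ) : 0 ≤ isq k := by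
  rw [isq_eq]; positivity

/-- Each coordinate square is at most `|k|²`. -/
theorem sq_le_isq (k : Fin 3 → ℤ) (i : Fin 3) : k i ^ 2 ≤ isq k := by
  rw [isq_eq]
  fin_cases i <;> simp <;> nlinarith [sq_nonneg (k 0), sq_nonneg (k 1), sq_nonneg (k 2)]

/-- The vector `(x, y, z) ↦ ![x, y, z]`. -/
def vec3 (t : ℤ × ℤ × ℤ) : Fin 3 → ℤ := ![t.1, t.2.1, t.2.2]

/-- `vec3` is injective. -/
theorem vec3_injective : Function.Injective vec3 := by
  intro s t h
  have h0 := congrFun h 0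
  have h1 := congrFun h 1
  have h2 := congrFun h 2
  simp only [vec3, Matrix.cons_val_zero, Matrix.cons_val_one, Matrix.cons_val] at h0 h1 h2
  exact Prod.ext h0 (Prod.ext h1 h2)

/-- Every wavevector is `vec3` of its coordinate triple. -/
theorem vec3_coords (k : Fin 3 → ℤ) : vec3 (k 0, k 1, k 2) = k := by
  funext i; fin_cases i <;> rfl

/-- The integer box `[-K, K]³` as a set of triples. -/
noncomputable def ibox (K : ℕ) : Finset (ℤ × ℤ × ℤ) :=
  Icc (-(K : ℤ)) K ×ˢ (Icc (-(K : ℤ)) K ×ˢ Icc (-(K : ℤ)) K)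

/-- THE LATTICE SHELL `{k ∈ ℤ³ : lo ≤ |k|² < hi}` (inside the box `[-K,K]³`) as a finite set of wavevectors. -/
noncomputable def shell (K lo hi : ℕ) : Finset (Fin 3 → ℤ) :=
  ((ibox K).filter (fun t : ℤ × ℤ × ℤ => (lo : ℤ) ≤ t.1 ^ 2 + t.2.1 ^ 2 + t.2.2 ^ 2 ∧
      t.1 ^ 2 + t.2.1 ^ 2 + t.2.2 ^ 2 < (hi : ℤ))).map ⟨vec3, vec3_injective⟩

/-- Membership, box form: `k ∈ shell K lo hi ⟺ (∀ i, |k i| ≤ K) ∧ lo ≤ |k|² < hi`. -/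
theorem mem_shell_iff_box {K lo hi : ℕ} {k : Fin 3 → ℤ} :
    k ∈ shell K lo hi ↔ (∀ i, |k i| ≤ K) ∧ (lo : ℤ) ≤ isq k ∧ isq k < hi := by
  unfold shell
  rw [Finset.mem_map]
  constructor
  · rintro ⟨t, ht, rfl⟩
    rw [Finset.mem_filter] at ht
    obtain ⟨hb, hp⟩ := ht
    simp only [ibox, Finset.mem_product, Finset.mem_Icc] at hb
    refine ⟨?_, ?_⟩
    · intro i
      fin_cases i <;> simp [vec3, abs_le] <;> omega
    · simpa [isq_eq, vec3] using hp
  · rintro ⟨hb, hp⟩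
    refine ⟨(k 0, k 1, k 2), ?_, vec3_coords k⟩
    rw [Finset.mem_filter]
    refine ⟨?_, ?_⟩
    · simp only [ibox, Finset.mem_product, Finset.mem_Icc]
      have h0 := hb 0; have h1 := hb 1; have h2 := hb 2
      rw [abs_le] at h0 h1 h2
      exact ⟨h0, h1, h2⟩
    · simpa [isq_eq] using hp

/-- THE BOX IS IMMATERIAL: if `hi ≤ (K+1)²` then `k ∈ shell K lo hi ⟺ lo ≤ |k|² < hi` — so `shell K lo hi`
IS the lattice shell, not a truncation of it. -/
theorem mem_shell_iff {K lo hi : ℕ} (hK : hi ≤ (K + 1) ^ 2) {k : Fin 3 → ℤ} :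
    k ∈ shell K lo hi ↔ (lo : ℤ) ≤ isq k ∧ isq k < hi := by
  rw [mem_shell_iff_box]
  constructor
  · exact fun h => h.2
  · intro h
    refine ⟨fun i => ?_, h⟩
    have h1 : k i ^ 2 < ((K : ℤ) + 1) ^ 2 := by
      calc k i ^ 2 ≤ isq k := sq_le_isq k i
        _ < hi := h.2
        _ ≤ ((K : ℤ) + 1) ^ 2 := by exact_mod_cast hK
    have h2 : |k i| < |(K : ℤ) + 1| := sq_lt_sq.mp h1
    rw [abs_of_nonneg (by positivity : (0 : ℤ) ≤ (K : ℤ) + 1)] at h2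
    omega

/-! ## 2. The structured count -/

/-- SIGN WEIGHT: the natural number `n` stands for the integers `±n` — one of them if `n = 0`, two otherwise. -/
def w (n : ℕ) : ℕ := if n = 0 then 1 else 2

/-- FOLDING A SYMMETRIC SUM: for an even summand, `Σ_{x=-K}^{K} G(x) = Σ_{n=0}^{K} w(n)·G(n)`. -/
theorem sum_Icc_symm {M : Type*} [AddCommMonoid M] (G : ℤ → M) (hG : ∀ x, G (-x) = G x) (K : ℕ) :
    ∑ x ∈ Icc (-(K : ℤ)) K, G x = ∑ n ∈ range (K + 1), w n • G n := by
  induction K with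
  | zero => simp [w]
  | succ K ih =>
    have hset : Icc (-((K + 1 : ℕ) : ℤ)) ((K + 1 : ℕ) : ℤ) =
        insert (-((K : ℤ) + 1)) (insert ((K : ℤ) + 1) (Icc (-(K : ℤ)) K)) := by
      ext x; simp only [Finset.mem_Icc, Finset.mem_insert]; push_cast; omega
    have hn1 : -((K : ℤ) + 1) ∉ insert ((K : ℤ) + 1) (Icc (-(K : ℤ)) K) := by
      simp only [Finset.mem_insert, Finset.mem_Icc]; omega
    have hn2 : ((K : ℤ) + 1) ∉ Icc (-(K : ℤ)) K := by
      simp only [Finset.mem_Icc]; omega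
    rw [hset, Finset.sum_insert hn1, Finset.sum_insert hn2, ih, Finset.sum_range_succ _ (K + 1), hG]
    have hw : w (K + 1) = 2 := by simp [w]
    rw [hw, two_nsmul]; push_cast; abel

/-- THE WEIGHTED COUNT over `ℕ³`: `S K lo hi = Σ_{a ≤ K} w(a) Σ_{b ≤ K} w(b) Σ_{c ≤ K} w(c)·[lo ≤ a²+b²+c² < hi]` —
`(K+1)³` natural-number terms, which is what the kernel evaluates below. -/
def S (K lo hi : ℕ) : ℕ :=
  ∑ a ∈ range (K + 1), w a * ∑ b ∈ range (K + 1), w b * ∑ c ∈ range (K + 1),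
    w c * (if lo ≤ a ^ 2 + b ^ 2 + c ^ 2 ∧ a ^ 2 + b ^ 2 + c ^ 2 < hi then 1 else 0)

/-- The integer indicator `[lo ≤ x²+y²+z² < hi]` with values in `ℕ`. -/
def ind (lo hi : ℕ) (x y z : ℤ) : ℕ :=
  if (lo : ℤ) ≤ x ^ 2 + y ^ 2 + z ^ 2 ∧ x ^ 2 + y ^ 2 + z ^ 2 < hi then 1 else 0

/-- On natural-number arguments the integer indicator is the natural-number indicator. -/
theorem ind_natCast (lo hi a b c : ℕ) :
    ind lo hi a b c = if lo ≤ a ^ 2 + b ^ 2 + c ^ 2 ∧ a ^ 2 + b ^ 2 + c ^ 2 < hi then 1 else 0 := by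
  unfold ind
  have h : ((lo : ℤ) ≤ (a : ℤ) ^ 2 + (b : ℤ) ^ 2 + (c : ℤ) ^ 2 ∧ (a : ℤ) ^ 2 + (b : ℤ) ^ 2 + (c : ℤ) ^ 2 < hi) ↔
      (lo ≤ a ^ 2 + b ^ 2 + c ^ 2 ∧ a ^ 2 + b ^ 2 + c ^ 2 < hi) := by
    constructor
    · rintro ⟨h1, h2⟩; exact ⟨by exact_mod_cast h1, by exact_mod_cast h2⟩
    · rintro ⟨h1, h2⟩; exact ⟨by exact_mod_cast h1, by exact_mod_cast h2⟩
  simp only [h]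

/-- The cardinality of the shell is the plain indicator sum over the integer box. -/
theorem card_shell_eq_sum (K lo hi : ℕ) :
    (shell K lo hi).card =
      ∑ x ∈ Icc (-(K : ℤ)) K, ∑ y ∈ Icc (-(K : ℤ)) K, ∑ z ∈ Icc (-(K : ℤ)) K, ind lo hi x y z := by
  unfold shell
  rw [Finset.card_map, Finset.card_filter]
  unfold ibox
  rw [Finset.sum_product]
  refine Finset.sum_congr rfl fun x _ => ?_
  rw [Finset.sum_product]
  refine Finset.sum_congr rfl fun y _ => Finset.sum_congr rfl fun z _ => ?_
  rfl

/-- THE STRUCTURED COUNT: `#shell K lo hi = S K lo hi` (fold each coordinate by `x ↦ |x|`). -/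
theorem card_shell (K lo hi : ℕ) : (shell K lo hi).card = S K lo hi := by
  rw [card_shell_eq_sum]
  -- innermost coordinate
  have h3 : ∀ x y : ℤ, ∑ z ∈ Icc (-(K : ℤ)) K, ind lo hi x y z =
      ∑ c ∈ range (K + 1), w c * ind lo hi x y c := by
    intro x y
    rw [sum_Icc_symm (fun z => ind lo hi x y z) (fun z => by simp only [ind, neg_sq]) K]
    simp only [smul_eq_mul]
  -- middle coordinate
  have h2 : ∀ x : ℤ, ∑ y ∈ Icc (-(K : ℤ)) K, ∑ z ∈ Icc (-(K : ℤ)) K, ind lo hi x y z =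
      ∑ b ∈ range (K + 1), w b * ∑ c ∈ range (K + 1), w c * ind lo hi x b c := by
    intro x
    simp only [h3]
    rw [sum_Icc_symm (fun y => ∑ c ∈ range (K + 1), w c * ind lo hi x y c)
      (fun y => by simp only [ind, neg_sq]) K]
    simp only [smul_eq_mul]
  simp only [h2]
  rw [sum_Icc_symm (fun x => ∑ b ∈ range (K + 1), w b * ∑ c ∈ range (K + 1), w c * ind lo hi x b c)
    (fun x => by simp only [ind, neg_sq]) K]
  simp only [smul_eq_mul, ind_natCast]
  rfl

/-! ## 3. The cell's bands and their mode counts -/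

/-- In-band `[2.5, 4.5)`: `7 ≤ |k|² < 21`. -/
noncomputable def shellIn : Finset (Fin 3 → ℤ) := shell 4 7 21
/-- Guard band `mid` `[4.5, 5)`: `21 ≤ |k|² < 25`. -/
noncomputable def shellMid : Finset (Fin 3 → ℤ) := shell 4 21 25
/-- Out-band (level one) `[5, 9)`: `25 ≤ |k|² < 81`. -/
noncomputable def shellOut : Finset (Fin 3 → ℤ) := shell 8 25 81
/-- Level-two band `out2i` `[9, 17)`: `81 ≤ |k|² < 289`. -/
noncomputable def shellOut2i : Finset (Fin 3 → ℤ) := shell 16 81 289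
/-- Information band `out2` `[10, 18)`: `100 ≤ |k|² < 324`. -/
noncomputable def shellOut2 : Finset (Fin 3 → ℤ) := shell 17 100 324
/-- Level-three band `out3i` `[17, 33)`: `289 ≤ |k|² < 1089`. -/
noncomputable def shellOut3i : Finset (Fin 3 → ℤ) := shell 32 289 1089

/-- `M_in = 308`. -/
theorem card_shellIn : shellIn.card = 308 := by
  rw [shellIn, card_shell]; decide +kernel

/-- `M_mid = 96` (only `|k|² ∈ {21, 22, 24}` occur: `23 ≡ 7 (mod 8)` is not a sum of three squares). -/
theorem card_shellMid : shellMid.card = 96 := by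
  rw [shellMid, card_shell]; decide +kernel

/-- `M_out = 2484`. -/
theorem card_shellOut : shellOut.card = 2484 := by
  rw [shellOut, card_shell]; decide +kernel

/-- `M_out2i = 17408`. -/
theorem card_shellOut2i : shellOut2i.card = 17408 := by
  rw [shellOut2i, card_shell]; decide +kernel

/-- `M_out2 = 20164`. -/
theorem card_shellOut2 : shellOut2.card = 20164 := by
  rw [shellOut2, card_shell]; decide +kernel

/-- `M_out3i = 129788`. -/
theorem card_shellOut3i : shellOut3i.card = 129788 := by
  rw [shellOut3i, card_shell]; decide +kernel

/-- MODE-COUNT RATIOS of consecutive octave bands against `λ³ = 8`: `M_out/M_in = 8.065…`, `M_out2i/M_out = 7.008…`,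
`M_out3i/M_out2i = 7.456…` (the continuum value is `8` at every level; the lattice ratios straddle it). -/
theorem card_ratios :
    (8.064 : ℝ) ≤ 2484 / 308 ∧ (2484 : ℝ) / 308 ≤ 8.066 ∧
    (7.008 : ℝ) ≤ 17408 / 2484 ∧ (17408 : ℝ) / 2484 ≤ 7.009 ∧
    (7.455 : ℝ) ≤ 129788 / 17408 ∧ (129788 : ℝ) / 17408 ≤ 7.456 := by
  norm_num

/-- CONTINUUM COMPARISON: the counts are within `3 %` of the shell volumes `(4π/3)(b³ − a³)` —
`308` vs `316.3` (`−2.6 %`), `2484` vs `2530.0` (`−1.8 %`), `17408` vs `17526` (`−0.7 %`), `129788` vs `129953` (`−0.13 %`). -/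
theorem card_vs_volume :
    |(308 : ℝ) - 4 / 3 * Real.pi * (4.5 ^ 3 - 2.5 ^ 3)| ≤ 0.03 * (4 / 3 * Real.pi * (4.5 ^ 3 - 2.5 ^ 3)) ∧
    |(2484 : ℝ) - 4 / 3 * Real.pi * (9 ^ 3 - 5 ^ 3)| ≤ 0.02 * (4 / 3 * Real.pi * (9 ^ 3 - 5 ^ 3)) ∧
    |(17408 : ℝ) - 4 / 3 * Real.pi * (17 ^ 3 - 9 ^ 3)| ≤ 0.01 * (4 / 3 * Real.pi * (17 ^ 3 - 9 ^ 3)) ∧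
    |(129788 : ℝ) - 4 / 3 * Real.pi * (33 ^ 3 - 17 ^ 3)| ≤ 0.002 * (4 / 3 * Real.pi * (33 ^ 3 - 17 ^ 3)) := by
  have h1 := Real.pi_gt_d6
  have h2 := Real.pi_lt_d6
  refine ⟨?_, ?_, ?_, ?_⟩ <;> rw [abs_le] <;> constructor <;> nlinarith


end Summit.NavierStokesRegularity.FluidComputer.BandModeCounts
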